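/-
Copyright: lit-balaban Phase-2 proof seat p09 (gen 8).  Statement-level skeleton of a published paper; no proof claims beyond what the
kernel checks below.
-/
import Literature.MathematicalPhysics.QuantumFieldTheory.BalabanImbrieJaffe1984to88.BIJ88ClocFactorsTorus

/-!
# `BalabanImbrieJaffe1984to88.BIJ88ClocEstimatesTorus` — T. Bałaban, J. Imbrie, A. Jaffe, *Effective action and cluster properties of the
abelian Higgs model*, Commun. Math. Phys. **114** (1988) 257–315 [BalabanImbrieJaffe1988]: the located sentence of p. 261 [PDF 5]
**«We have estimates analogous to (2.5)–(2.7) for C^{(k)}_{loc}.»** PROVED ON THE TORI OF THE SERIES, WITH NO HYPOTHESIS, for the localized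
covariance (2.8)–(2.9) built from the unit-lattice propagator `C^{(k)}` OF RECORD (file 2 of 2; file 1 = `BIJ88ClocFactorsTorus`: the sandwich
factors and (2.10) for `C^{(k)}` itself)

statement-level skeleton of published theorems with citation tags; proofs where landed; nothing here is a claim about the Yang–Mills mass gap

PDF held: `paper:balaban1988-cmp114-bij-abelian-higgs-effective-action` (journal page = PDF page + 256); pp. 260–261 [PDF 4–5] re-read this session
from the text layer (`lit read paper:balaban1988-cmp114-bij-abelian-higgs-effective-action --pages 3-6`, files `p0004.txt`–`p0006.txt`).

CITATION HEADER (lean-in-tree rule).  Part of the lit-balaban TYPED SKELETON (HOME `run/shared/lean/pub/lit-balaban/`), Phase 2, seat p09 GEN 8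
(unit `lit-balaban-p09`; free-target protocol G.5-34(d), TAKING line HOME/STATUS.md 2026-08-21T20:22:32Z); rows **C2.Eq2.8 / C2.Eq2.9 /
C2.Eq2.10** of `HOME/SKELETON.md` (C2 §§1–4 fold owner r18, referee ref-5) — the sentence has no row of its own (owner's call, cf. C2.Claim@263).
Decls used BY NAME: gen 6's `BIJ85Ineq723TorusCE.ineq723_CE` ((7.2.3) of [BalabanImbrieJaffe1985] for the `C^{(k)}` of record at the native
weights — a THEOREM, no hypothesis), file 1 (`Lfac`/`Rfac` locality and ℓ¹ bounds, `Cmat`, `qKer_mul_Cmat`/`Cmat_mul_qstKer`), p02's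
`BIJ88Eq211Proof.clocKer` ((2.9) as a kernel), r18's shapes `BIJ88Sect2Statements.trunc`/`Decay`/`Vanishes`/`Close`/`rLen`, the pub-balaban
sandwich lemma `B6FromB4.sandwich_decay`; p36's p. 311 identity (`BIJ88CovSandwich311.self_sub_cLoc`) is re-done here at kernel level for the
rectangular torus kernels (`self_sub_clocKer_of_eq210`) rather than imported.

THE PRINTED TEXT (verbatim, pp. 260–261 [PDF 4–5]).  *"So we have |H_{k,loc}(b,b′)| ≦ ce^{−c dist(b,b′)}, (2.5)  H_{k,loc}(b,b′) = 0 for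
dist(b,b′) ≧ ⅛r(e_k), (2.6)  |H_{k,loc}(b,b′) − H_k(b,b′)| ≦ e^{−cr(e_k)}e^{−c dist(b,b′)}, (2.7) … Next we consider C^{(k)}, the covariance
of the k-th step gauge field. This is defined on the unit lattice T^{(k)}_{0,1}. First define C̃^{(k)}(b₁,b₂) = C^{(k)}(b₁,b₂), if dist(b₁,b₂) ≦
¼r(e_k), 0, otherwise, (2.8) and extend by translation invariance to T₁^{(k)}. Then put C^{(k)}_{loc} = (I − Q^{s*}Q)C̃^{(k)}(I − Q*Q^s); (2.9) …
We have estimates analogous to (2.5)–(2.7) for C^{(k)}_{loc}."*  The print gives no proof ("analogous"); the mechanism formalized here is the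
evident one: the two sandwich factors of (2.9) are local (range two blocks) and ℓ¹-bounded (file 1), so they transport the decay (7.2.3) of
`C^{(k)}` and the support of the truncation (2.8); and `C^{(k)} − C^{(k)}_{loc} = (I − Q^{s*}Q)(C^{(k)} − C̃^{(k)})(I − Q*Q^s)` once (2.10) holds for
`C^{(k)}` itself (file 1 §3; the p. 311 identity of p36's `BIJ88CovSandwich311`), with `C^{(k)} − C̃^{(k)}` small beyond the radius.

THE OBJECTS (tori of `Balaban1983to89.Setup`; fine bonds `PBond P j` = `T₁^{(k)}`, coarse bonds `PBond P (j+1)`; standing range `j + 1 ≤ m + K`;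
`|b − b′|` := file 1's `distB` = `supDist b₋ b′₋`): `Ctil P j R` — (2.8): `trunc distB R Cmat`;  `Cloc P j R` — (2.9):
`clocKer (qKer P j) (qstKer P j) (qsKer ·) (qsstKer ·) (Ctil P j R)` = `Lfac · Ctil · Rfac` (`Cloc_eq`).

WHAT IS PROVED (0 `sorry`, standard axioms, no named facts).
* §0 generic: `sandwich_vanishes` (a kernel vanishing beyond `R₀`, sandwiched between factors of range `r`, vanishes beyond `R₀ + 2r`);
  `clocKer_sub`, `clocKer_eq_self_of_eq210` (`QC = 0 ∧ CQ* = 0 ⇒ (1 − Q^{s*}Q)C(1 − Q*Q^s) = C`), `self_sub_clocKer_of_eq210`.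
* §4 on the torus: `Ctil_apply`, `Ctil_eq_zero_of_lt`, `abs_Ctil_le` (`|C̃| ≤ |C|`-type), `abs_sub_Ctil_le` (the far part `|C − C̃| ≤
  Me^{−(δ/2)R}e^{−(δ/2)|·|}`), **`Cmat_sub_Cloc_eq`** (`C − C_loc = Lfac·(C − C̃)·Rfac`, hypothesis-free for `d ≥ 2`, `j + 1 ≤ m + K`); the steps
  `cloc_eq_zero_of_far`, `abs_cloc_le_of_bound`, `abs_cloc_sub_le_of_bound`; and THE THREE ESTIMATES with constants depending on `(d, L)` ONLY,
  every torus of these `(d ≥ 2, L)`, every `j + 1 ≤ m + K`, EVERY radius `R`: **`cloc_estimates`** (master: ∃ `M, δ > 0` with (7.2.3) for `Cmat`,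
  DECAY `|C_loc(b,b′)| ≤ Me^{4δL}(1+L)²e^{−δ|b−b′|}`, VANISHING `C_loc(b,b′) = 0` for `|b − b′| > R + 4L`, CLOSENESS `|C_loc(b,b′) − C(b,b′)| ≤
  Me^{2δL}(1+L)²e^{−(δ/2)R}e^{−(δ/2)|b−b′|}`); separately in the (2.5)/(2.6)/(2.7) shapes **`cloc_decay`**, **`cloc_vanishes`** (r18's
  `Vanishes distB (Cloc P j R) R′`, every `R′ > R + 4L`), **`cloc_close`** (r18's `Close distB (Cloc P j R) (Cmat P j) (M″e^{−(δ/2)R}) (δ/2)`),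
  `cloc_decay_rescaled` (r18's one-letter `Decay (κ·distB) (Cloc P j R) c`); and at the PRINTED radius `R = ¼r(e_k)` (`rLen r e_k / 4`):
  **`cloc_estimates_261`** (closeness prefactor `M″e^{−(δ/8)r(e_k)}` = the print's `e^{−cr(e_k)}`).
HONEST SCOPE.  (i) «analogous to (2.5)–(2.7)» is read as: decay / finite range / closeness to `C^{(k)}` of the kernel (2.9), in the `ℓ^∞` source
distance of the (7.2.3) files (the paper's `dist(b₁,b₂)` on `T₁^{(k)}` is not specified further); the finite range comes out as `R + 4L` for the
truncation radius `R` (each sandwich factor widens the support by two blocks) — the print states no constant; r18's one-letter shape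
`|K| ≤ ce^{−c dist}` is met in a rescaled distance only (`cloc_decay_rescaled`) — the two-constant forms are the faithful ones.  (ii) Torus
(periodic b.c.), U(1), real fields, `d ≥ 2`, scales `j + 1 ≤ m + K` (a next block level exists) — the range of `ineq723_CE`; the *"extend by
translation invariance to T₁^{(k)}"* clause is moot on the torus of record (the kernel is defined on all of it).  (iii) Constants existential
through (7.2.3) (`M, δ` from `(d, L)`), the `L`-dependence of the sandwich explicit; uniform in `k` and in the volume as printed.  (iv) (2.11) is
p02's `BIJ88Eq211Proof` and is not restated; estimates for `∂`- and Hölder derivatives (printed only for `H_{k,loc}`) are not part of this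
sentence.  Two `def`s with bodies (`Ctil`, `Cloc`) and one private pseudo-metric structure, no `def … : Prop`, no new named fact (D-0026).
NOTHING beyond the kernel-checked statements is asserted; NOT summit progress.  Unit `lit-balaban-p09` (literature-prover-lit-balaban-p09-g8-0),
2026-08-21.
-/

namespace Literature.MathematicalPhysics.QuantumFieldTheory.BalabanImbrieJaffe1984to88.BIJ88ClocEstimatesTorus

open Literature.MathematicalPhysics.QuantumFieldTheory.Balaban1983to89
open scoped BigOperators Matrix RealInnerProductSpace
open LatticeFieldCalculus BIJ85Sect2SurfaceAverages BIJ85Eq219Proof BIJ85Eq213Adjoint BIJ88Eq211Proof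
open BIJ88Sect2Statements (trunc Decay Vanishes Close Eq210 rLen)
open BIJ85AxialPropagator411 (curlOp V411)
open BIJ85UnitPropagator433 (unitPropagator unitPropagator_symm)
open BIJ85Prop521Torus (CoarseSpace toEj QsE Wstep mem_Wstep)
open BIJ85Prop522Torus (CE)
open BIJ85Ineq723TorusCE (toEj_single inner_toEj_single_left ineq723_CE)

open BIJ88ClocFactorsTorus

noncomputable section
/-! ## §0  Generic kernel lemmas: a local sandwich `L·D·R` -/

section Sandwich

variable {m n : Type} [Fintype m] {X : Type} [PseudoMetricSpace X]

/-- **the mechanism of the (2.6)-analogue**: if `D(u,v) = 0` beyond distance `R₀`, the left factor has range `≤ r` (`L(i,u) ≠ 0 ⇒ dist(i,u) ≤ r`)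
and the right factor has range `≤ r`, then `(LDR)(i,k) = 0` beyond `R₀ + 2r` (triangle inequality on the support; companion of the pub-balaban
decay lemma `B6FromB4.sandwich_decay`). [cite: BalabanImbrieJaffe1988, (2.6) p.260] -/
theorem sandwich_vanishes {r R₀ : ℝ} (pos : m → X) (pos' : n → X)
    (L : Matrix n m ℝ) (D : Matrix m m ℝ) (R : Matrix m n ℝ)
    (hL : ∀ i u, L i u ≠ 0 → dist (pos' i) (pos u) ≤ r)
    (hR : ∀ v k, R v k ≠ 0 → dist (pos v) (pos' k) ≤ r)
    (hD : ∀ u v, R₀ < dist (pos u) (pos v) → D u v = 0) :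
    ∀ i k, R₀ + 2 * r < dist (pos' i) (pos' k) → (L * D * R) i k = 0 := by
  intro i k hik
  rw [Matrix.mul_apply]
  refine Finset.sum_eq_zero fun v _ => ?_
  rw [Matrix.mul_apply, Finset.sum_mul]
  refine Finset.sum_eq_zero fun u _ => ?_
  by_cases hLu : L i u = 0
  · rw [hLu, zero_mul, zero_mul]
  by_cases hRv : R v k = 0
  · rw [hRv, mul_zero]
  have h1 := hL i u hLu
  have h2 := hR v k hRv
  have h3 : R₀ < dist (pos u) (pos v) := by
    have := dist_triangle (pos' i) (pos u) (pos' k)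
    have := dist_triangle (pos u) (pos v) (pos' k)
    linarith
  rw [hD u v h3, mul_zero, zero_mul]

end Sandwich

/-! ## §0′  The (2.9) sandwich as algebra: linearity in the middle factor, and `= C` under (2.10) for `C` -/

section ClocAlgebra

variable {β κ : Type*} [Fintype β] [Fintype κ] [DecidableEq β]

/-- (2.9) is linear in the truncated kernel: `(1 − Q^{s*}Q)(C − C′)(1 − Q*Q^s) = C_loc[C] − C_loc[C′]`. [cite: BalabanImbrieJaffe1988, (2.9) p.261] -/
theorem clocKer_sub (q : Matrix κ β ℝ) (qst : Matrix β κ ℝ) (qs : Matrix κ β ℝ) (qsst : Matrix β κ ℝ) (C C' : Matrix β β ℝ) :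
    clocKer q qst qs qsst (C - C') = clocKer q qst qs qsst C - clocKer q qst qs qsst C' := by
  show (1 - qsst * q) * (C - C') * (1 - qst * qs) = (1 - qsst * q) * C * (1 - qst * qs) - (1 - qsst * q) * C' * (1 - qst * qs)
  rw [Matrix.mul_sub (1 - qsst * q) C C', Matrix.sub_mul ((1 - qsst * q) * C) ((1 - qsst * q) * C') (1 - qst * qs)]

/-- **the "like C^{(k)}" mechanism at kernel level**: if `QC = 0` and `CQ* = 0` ((2.10) for `C` itself) then the (2.9) sandwich does not change
`C`: `(1 − Q^{s*}Q)C(1 − Q*Q^s) = C` (p36's ring-level `BIJ88CovSandwich311.sandwich_eq_self`, here for the rectangular kernels of the torus).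
[cite: BalabanImbrieJaffe1988, (2.10) p.261] -/
theorem clocKer_eq_self_of_eq210 {q : Matrix κ β ℝ} {qst : Matrix β κ ℝ} (qs : Matrix κ β ℝ) (qsst : Matrix β κ ℝ) {C : Matrix β β ℝ}
    (hq : q * C = 0) (hqst : C * qst = 0) : clocKer q qst qs qsst C = C := by
  unfold clocKer
  rw [Matrix.sub_mul, Matrix.one_mul, Matrix.mul_assoc qsst q C, hq, Matrix.mul_zero, sub_zero, Matrix.mul_sub, Matrix.mul_one,
    ← Matrix.mul_assoc C qst qs, hqst, Matrix.zero_mul, sub_zero]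

/-- … hence `C − C_loc = (1 − Q^{s*}Q)(C − C̃)(1 − Q*Q^s)` (p36's p. 311 identity `self_sub_cLoc`, kernel level).
[cite: BalabanImbrieJaffe1988, (2.9) p.261] -/
theorem self_sub_clocKer_of_eq210 {q : Matrix κ β ℝ} {qst : Matrix β κ ℝ} (qs : Matrix κ β ℝ) (qsst : Matrix β κ ℝ) {C : Matrix β β ℝ}
    (hq : q * C = 0) (hqst : C * qst = 0) (Ct : Matrix β β ℝ) :
    C - clocKer q qst qs qsst Ct = clocKer q qst qs qsst (C - Ct) := by
  rw [clocKer_sub, clocKer_eq_self_of_eq210 qs qsst hq hqst]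

end ClocAlgebra

/-! ## §4  (2.8), (2.9) on the torus and the three estimates «analogous to (2.5)–(2.7)» -/

section Estimates

variable {P : Params} {j : ℕ} [DecidableEq (PBond P j)]

variable (P j) in
/-- **(2.8) on the torus**: `C̃^{(k)} = trunc_R C^{(k)}` — `C̃(b₁,b₂) = C(b₁,b₂)` if `|b₁ − b₂| ≤ R`, `0` otherwise (r18's `trunc`; the printed radius is
`R = ¼r(e_k)`). [cite: BalabanImbrieJaffe1988, (2.8) p.261] -/
def Ctil (R : ℝ) : Matrix (PBond P j) (PBond P j) ℝ := Matrix.of (trunc (distB P j) R (Cmat P j))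

variable (P j) in
/-- **(2.9) on the torus**: `C^{(k)}_{loc} = (1 − Q^{s*}Q)C̃^{(k)}(1 − Q*Q^s)` with the concrete kernels `Q` (2.13), `Q*` (2.14), `Q^s` (2.16),
`Q^{s*}` (2.17) of the torus block geometry (p02's `clocKer`, p31's `BIJ88Eq210Torus`). [cite: BalabanImbrieJaffe1988, (2.9) p.261] -/
def Cloc (R : ℝ) : Matrix (PBond P j) (PBond P j) ℝ :=
  clocKer (qKer P j) (qstKer P j) (qsKer (torusBlockBonds P j)) (qsstKer (torusBlockBonds P j)) (Ctil P j R)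

/-- `C_loc = Lfac · C̃ · Rfac`. [cite: BalabanImbrieJaffe1988, (2.9) p.261] -/
theorem Cloc_eq (R : ℝ) : Cloc P j R = Lfac P j * Ctil P j R * Rfac P j := rfl

/-- (2.8) unfolded: `C̃(u,v) = C(u,v)` within the radius, `0` beyond. [cite: BalabanImbrieJaffe1988, (2.8) p.261] -/
theorem Ctil_apply (R : ℝ) (u v : PBond P j) : Ctil P j R u v = if distB P j u v ≤ R then Cmat P j u v else 0 := rfl

/-- (2.8): `C̃(u,v) = 0` for `|u − v| > R`. [cite: BalabanImbrieJaffe1988, (2.8) p.261] -/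
theorem Ctil_eq_zero_of_lt {R : ℝ} {u v : PBond P j} (h : R < distB P j u v) : Ctil P j R u v = 0 := by
  rw [Ctil_apply, if_neg (not_le.mpr h)]

/-- (2.8): `|C̃| ≤ |C|` entrywise, so `C̃` inherits every bound `|C(u,v)| ≤ Me^{−δ|u−v|}`. [cite: BalabanImbrieJaffe1988, (2.8) p.261] -/
theorem abs_Ctil_le {M δ : ℝ} (hM : 0 ≤ M) (hC : ∀ u v, |Cmat P j u v| ≤ M * Real.exp (-(δ * distB P j u v))) (R : ℝ) (u v : PBond P j) :
    |Ctil P j R u v| ≤ M * Real.exp (-(δ * distB P j u v)) := by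
  rw [Ctil_apply]
  split_ifs
  · exact hC u v
  · rw [abs_zero]
    positivity

/-- (2.8): the far part `C − C̃` is `O(e^{−(δ/2)R})`: `|C(u,v) − C̃(u,v)| ≤ Me^{−(δ/2)R}e^{−(δ/2)|u−v|}` given `|C| ≤ Me^{−δ|·|}` (two-constant form
of p36's `BIJ88CovSandwich311.abs_sub_trunc_le`). [cite: BalabanImbrieJaffe1988, (2.8) p.261] -/
theorem abs_sub_Ctil_le {M δ : ℝ} (hM : 0 ≤ M) (hδ : 0 ≤ δ) (hC : ∀ u v, |Cmat P j u v| ≤ M * Real.exp (-(δ * distB P j u v)))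
    (R : ℝ) (u v : PBond P j) :
    |Cmat P j u v - Ctil P j R u v| ≤ M * Real.exp (-(δ / 2 * R)) * Real.exp (-(δ / 2 * distB P j u v)) := by
  rw [Ctil_apply]
  split_ifs with h
  · rw [sub_self, abs_zero]
    positivity
  · rw [sub_zero]
    rw [not_le] at h
    refine (hC u v).trans ?_
    rw [mul_assoc, ← Real.exp_add]
    gcongr
    have : δ / 2 * R ≤ δ / 2 * distB P j u v := mul_le_mul_of_nonneg_left h.le (by positivity)
    linarith

/-- **`C^{(k)} − C^{(k)}_{loc} = (1 − Q^{s*}Q)(C^{(k)} − C̃^{(k)})(1 − Q*Q^s)` ON THE TORUS** (p36's p. 311 identity, its hypothesis (2.10)-for-`C`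
DISCHARGED by §3). [cite: BalabanImbrieJaffe1988, (2.9) p.261] -/
theorem Cmat_sub_Cloc_eq (hd : 2 ≤ P.d) (hj : j + 1 ≤ P.m + P.K) (R : ℝ) :
    Cmat P j - Cloc P j R = Lfac P j * (Cmat P j - Ctil P j R) * Rfac P j :=
  self_sub_clocKer_of_eq210 _ _ qKer_mul_Cmat (Cmat_mul_qstKer hd hj) (Ctil P j R)

/-- the bonds of `T₁^{(k)}` with `distB` as a pseudo-metric space (inside proofs only, to apply the sandwich lemmas). [folklore] -/
@[reducible] private def bondPMS (P : Params) (j : ℕ) : PseudoMetricSpace (PBond P j) where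
  dist b b' := distB P j b b'
  dist_self b := distB_self b
  dist_comm b b' := distB_comm b b'
  dist_triangle b b' b'' := by
    simp only [distB_apply]
    exact_mod_cast BIJ85Ineq722Torus.supDist_triangle b.src b'.src b''.src

/-- **THE (2.6)-ANALOGUE, FINITE RANGE**: `C^{(k)}_{loc}(b,b′) = 0` for `|b − b′| > R + 4L` — every scale `j + 1 ≤ m + K`, every radius `R`, every
torus (the truncation (2.8) has range `R`, each sandwich factor range `2L`). [cite: BalabanImbrieJaffe1988, (2.6) p.260] -/
theorem cloc_eq_zero_of_far (hj : j + 1 ≤ P.m + P.K) (R : ℝ) {b b' : PBond P j} (h : R + 4 * (P.L : ℝ) < distB P j b b') :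
    Cloc P j R b b' = 0 := by
  letI : PseudoMetricSpace (PBond P j) := bondPMS P j
  have hdist : ∀ a a' : PBond P j, dist a a' = distB P j a a' := fun _ _ => rfl
  have hv := sandwich_vanishes (r := 2 * (P.L : ℝ)) (R₀ := R) (fun a : PBond P j => a) (fun a : PBond P j => a)
    (Lfac P j) (Ctil P j R) (Rfac P j)
    (fun i u hiu => by rw [hdist]; exact distB_le_of_Lfac_ne_zero hj hiu)
    (fun v k hvk => by rw [hdist]; exact distB_le_of_Rfac_ne_zero hj hvk)
    (fun u v huv => Ctil_eq_zero_of_lt (by rw [hdist] at huv; exact huv)) b b'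
  rw [Cloc_eq]
  exact hv (by rw [hdist]; linarith)

/-- the (2.6)-analogue in r18's typed shape `Vanishes`: for every `R′ > R + 4L`, `Vanishes distB C^{(k)}_{loc} R′`.
[cite: BalabanImbrieJaffe1988, (2.6) p.260] -/
theorem cloc_vanishes (hj : j + 1 ≤ P.m + P.K) (R R' : ℝ) (hR' : R + 4 * (P.L : ℝ) < R') :
    Vanishes (distB P j) (Cloc P j R) R' :=
  fun _ _ hbb' => cloc_eq_zero_of_far hj R (lt_of_lt_of_le hR' hbb')

/-- the decay step: any entrywise bound `|C(u,v)| ≤ Me^{−δ|u−v|}` (`M, δ ≥ 0`) on the torus propagator passes to `C^{(k)}_{loc}` with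
`M ↦ Me^{4δL}(1+L)²` (sandwich factors of range `2L` and ℓ¹-norms `≤ 1 + L`; `B6FromB4.sandwich_decay`). [cite: BalabanImbrieJaffe1988, (2.5) p.260] -/
theorem abs_cloc_le_of_bound (hj : j + 1 ≤ P.m + P.K) {M δ : ℝ} (hM : 0 ≤ M) (hδ : 0 ≤ δ)
    (hC : ∀ u v, |Cmat P j u v| ≤ M * Real.exp (-(δ * distB P j u v))) (R : ℝ) (b b' : PBond P j) :
    |Cloc P j R b b'| ≤ M * Real.exp (2 * δ * (2 * P.L)) * (1 + P.L) * (1 + P.L) * Real.exp (-(δ * distB P j b b')) := by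
  letI : PseudoMetricSpace (PBond P j) := bondPMS P j
  have hdist : ∀ a a' : PBond P j, dist a a' = distB P j a a' := fun _ _ => rfl
  have h := B6FromB4.sandwich_decay (fun a : PBond P j => a) (fun a : PBond P j => a) (Lfac P j) (Ctil P j R) (Rfac P j)
    hM hδ
    (fun i u hiu => by rw [hdist]; exact distB_le_of_Lfac_ne_zero hj hiu) (fun i => Lfac_row_le i)
    (fun v k hvk => by rw [hdist]; exact distB_le_of_Rfac_ne_zero hj hvk) (fun k => Rfac_col_le k)
    (fun u v => by rw [hdist]; exact abs_Ctil_le hM hC R u v) b b'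
  rw [Cloc_eq]
  rw [hdist] at h
  exact h

/-- the closeness step: under the same bound (and (2.10) for `C`, §3), `|C^{(k)}_{loc}(b,b′) − C^{(k)}(b,b′)| ≤ Me^{2δL}(1+L)²e^{−(δ/2)R}e^{−(δ/2)|b−b′|}`
(the far part `C − C̃` sandwiched; `d ≥ 2`). [cite: BalabanImbrieJaffe1988, (2.7) p.260] -/
theorem abs_cloc_sub_le_of_bound (hd : 2 ≤ P.d) (hj : j + 1 ≤ P.m + P.K) {M δ : ℝ} (hM : 0 ≤ M) (hδ : 0 ≤ δ)
    (hC : ∀ u v, |Cmat P j u v| ≤ M * Real.exp (-(δ * distB P j u v))) (R : ℝ) (b b' : PBond P j) :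
    |Cloc P j R b b' - Cmat P j b b'| ≤
      M * Real.exp (2 * (δ / 2) * (2 * P.L)) * (1 + P.L) * (1 + P.L) * Real.exp (-(δ / 2 * R)) *
        Real.exp (-(δ / 2 * distB P j b b')) := by
  letI : PseudoMetricSpace (PBond P j) := bondPMS P j
  have hdist : ∀ a a' : PBond P j, dist a a' = distB P j a a' := fun _ _ => rfl
  have hM' : 0 ≤ M * Real.exp (-(δ / 2 * R)) := by positivity
  have h := B6FromB4.sandwich_decay (fun a : PBond P j => a) (fun a : PBond P j => a) (Lfac P j) (Cmat P j - Ctil P j R) (Rfac P j)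
    hM' (by positivity : (0 : ℝ) ≤ δ / 2)
    (fun i u hiu => by rw [hdist]; exact distB_le_of_Lfac_ne_zero hj hiu) (fun i => Lfac_row_le i)
    (fun v k hvk => by rw [hdist]; exact distB_le_of_Rfac_ne_zero hj hvk) (fun k => Rfac_col_le k)
    (fun u v => by rw [hdist, Matrix.sub_apply]; exact abs_sub_Ctil_le hM hδ hC R u v) b b'
  rw [abs_sub_comm, ← Matrix.sub_apply, Cmat_sub_Cloc_eq hd hj R]
  rw [hdist] at h
  refine h.trans (le_of_eq ?_)
  ring

/-- **THE SENTENCE, MASTER FORM**: there are `M, δ > 0` DEPENDING ON `(d, L)` ONLY such that on every torus of the series with these `d ≥ 2`, `L`,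
every scale `j + 1 ≤ m + K` and every truncation radius `R`: (7.2.3) `|C^{(k)}(b,b′)| ≤ Me^{−δ|b−b′|}`; the (2.5)-analogue
`|C^{(k)}_{loc}(b,b′)| ≤ Me^{4δL}(1+L)²·e^{−δ|b−b′|}`; the (2.6)-analogue `C^{(k)}_{loc}(b,b′) = 0` for `|b − b′| > R + 4L`; the (2.7)-analogue
`|C^{(k)}_{loc}(b,b′) − C^{(k)}(b,b′)| ≤ Me^{2δL}(1+L)²e^{−(δ/2)R}·e^{−(δ/2)|b−b′|}` — NO HYPOTHESIS ((7.2.3) is gen 6's theorem `ineq723_CE`).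
[cite: BalabanImbrieJaffe1988, (2.9) p.261] -/
theorem cloc_estimates (d L : ℕ) (hd : 2 ≤ d) :
    ∃ M δ : ℝ, 0 < M ∧ 0 < δ ∧ ∀ (P : Params), P.d = d → P.L = L → ∀ (j : ℕ) (_ : DecidableEq (PBond P j)),
      j + 1 ≤ P.m + P.K → ∀ (R : ℝ) (b b' : PBond P j),
        |Cmat P j b b'| ≤ M * Real.exp (-(δ * distB P j b b')) ∧
        |Cloc P j R b b'| ≤ M * Real.exp (4 * δ * L) * (1 + L) ^ 2 * Real.exp (-(δ * distB P j b b')) ∧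
        (R + 4 * L < distB P j b b' → Cloc P j R b b' = 0) ∧
        |Cloc P j R b b' - Cmat P j b b'| ≤
          M * Real.exp (2 * δ * L) * (1 + L) ^ 2 * Real.exp (-(δ / 2 * R)) * Real.exp (-(δ / 2 * distB P j b b')) := by
  obtain ⟨M, δ, hM, hδ, H⟩ := ineq723_CE d L hd
  refine ⟨M, δ, hM, hδ, fun P hP hPL j inst hj R b b' => ?_⟩
  have hPd : 2 ≤ P.d := hP ▸ hd
  have hC : ∀ u v : PBond P j, |Cmat P j u v| ≤ M * Real.exp (-(δ * distB P j u v)) := fun u v => H P hP hPL j inst hj u v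
  refine ⟨hC b b', ?_, fun hfar => cloc_eq_zero_of_far hj R (by rw [hPL]; exact hfar), ?_⟩
  · have h := abs_cloc_le_of_bound hj hM.le hδ.le hC R b b'
    rw [← hPL]
    refine h.trans (le_of_eq ?_)
    ring_nf
  · have h := abs_cloc_sub_le_of_bound hPd hj hM.le hδ.le hC R b b'
    rw [← hPL]
    refine h.trans (le_of_eq ?_)
    ring_nf

/-- **THE (2.5)-ANALOGUE, DECAY**: `|C^{(k)}_{loc}(b,b′)| ≤ M′e^{−δ′|b−b′|}` with `M′, δ′ > 0` depending on `(d, L)` only — every torus, every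
`j + 1 ≤ m + K`, every radius `R`, all bonds. [cite: BalabanImbrieJaffe1988, (2.5) p.260] -/
theorem cloc_decay (d L : ℕ) (hd : 2 ≤ d) :
    ∃ M' δ' : ℝ, 0 < M' ∧ 0 < δ' ∧ ∀ (P : Params), P.d = d → P.L = L → ∀ (j : ℕ) (_ : DecidableEq (PBond P j)),
      j + 1 ≤ P.m + P.K → ∀ (R : ℝ) (b b' : PBond P j),
        |Cloc P j R b b'| ≤ M' * Real.exp (-(δ' * distB P j b b')) := by
  obtain ⟨M, δ, hM, hδ, H⟩ := cloc_estimates d L hd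
  exact ⟨M * Real.exp (4 * δ * L) * (1 + L) ^ 2, δ, by positivity, hδ,
    fun P hP hPL j inst hj R b b' => (H P hP hPL j inst hj R b b').2.1⟩

/-- the (2.5)-analogue in r18's one-letter typed shape `Decay` (`|K| ≤ ce^{−c·dist}`), which can only be met in a RESCALED distance `κ|b − b′|`:
with `c = max(M′, δ′)`, `κ = δ′/c`. [cite: BalabanImbrieJaffe1988, (2.5) p.260] -/
theorem cloc_decay_rescaled (d L : ℕ) (hd : 2 ≤ d) :
    ∃ κ c : ℝ, 0 < κ ∧ 0 < c ∧ ∀ (P : Params), P.d = d → P.L = L → ∀ (j : ℕ) (_ : DecidableEq (PBond P j)),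
      j + 1 ≤ P.m + P.K → ∀ (R : ℝ), Decay (fun b b' => κ * distB P j b b') (Cloc P j R) c := by
  obtain ⟨M', δ', hM', hδ', H⟩ := cloc_decay d L hd
  have hc : 0 < max M' δ' := lt_max_of_lt_left hM'
  refine ⟨δ' / max M' δ', max M' δ', by positivity, hc, fun P hP hPL j inst hj R b b' => ?_⟩
  have h := H P hP hPL j inst hj R b b'
  have hne : max M' δ' ≠ 0 := hc.ne'
  have hκ : -max M' δ' * (δ' / max M' δ' * distB P j b b') = -(δ' * distB P j b b') := by
    field_simp
  show |Cloc P j R b b'| ≤ max M' δ' * Real.exp (-max M' δ' * (δ' / max M' δ' * distB P j b b'))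
  rw [hκ]
  exact h.trans (mul_le_mul_of_nonneg_right (le_max_left _ _) (Real.exp_nonneg _))

/-- **THE (2.7)-ANALOGUE, CLOSENESS**, in r18's typed shape: `Close distB C^{(k)}_{loc} C^{(k)} (M″e^{−(δ/2)R}) (δ/2)`, i.e.
`|C^{(k)}_{loc}(b,b′) − C^{(k)}(b,b′)| ≤ M″e^{−(δ/2)R}·e^{−(δ/2)|b−b′|}`, `M″, δ > 0` from `(d, L)` only — every torus, every `j + 1 ≤ m + K`, every
`R` (at `R = ¼r(e_k)` the prefactor is the print's `e^{−cr(e_k)}`, `cloc_estimates_261`). [cite: BalabanImbrieJaffe1988, (2.7) p.260] -/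
theorem cloc_close (d L : ℕ) (hd : 2 ≤ d) :
    ∃ M'' δ : ℝ, 0 < M'' ∧ 0 < δ ∧ ∀ (P : Params), P.d = d → P.L = L → ∀ (j : ℕ) (_ : DecidableEq (PBond P j)),
      j + 1 ≤ P.m + P.K → ∀ (R : ℝ), Close (distB P j) (Cloc P j R) (Cmat P j) (M'' * Real.exp (-(δ / 2 * R))) (δ / 2) := by
  obtain ⟨M, δ, hM, hδ, H⟩ := cloc_estimates d L hd
  refine ⟨M * Real.exp (2 * δ * L) * (1 + L) ^ 2, δ, by positivity, hδ, fun P hP hPL j inst hj R b b' => ?_⟩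
  have h := (H P hP hPL j inst hj R b b').2.2.2
  rw [neg_mul]
  exact h

/-- **THE SENTENCE AT THE PRINTED RADIUS `R = ¼r(e_k)`** (`r(e_k) = |log e_k^{−1}|^r`, r18's `rLen`): with `M, δ > 0` from `(d, L)` only, for every
torus, scale `j + 1 ≤ m + K` and every `r, e_k`: decay `|C_loc(b,b′)| ≤ Me^{4δL}(1+L)²e^{−δ|b−b′|}` ((2.5)-shape), `C_loc(b,b′) = 0` for
`|b − b′| > ¼r(e_k) + 4L` ((2.6)-shape), `|C_loc(b,b′) − C(b,b′)| ≤ Me^{2δL}(1+L)²e^{−(δ/8)r(e_k)}e^{−(δ/2)|b−b′|}` ((2.7)-shape, prefactor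
`e^{−cr(e_k)}`). [cite: BalabanImbrieJaffe1988, (2.8) p.261] -/
theorem cloc_estimates_261 (d L : ℕ) (hd : 2 ≤ d) :
    ∃ M δ : ℝ, 0 < M ∧ 0 < δ ∧ ∀ (P : Params), P.d = d → P.L = L → ∀ (j : ℕ) (_ : DecidableEq (PBond P j)),
      j + 1 ≤ P.m + P.K → ∀ (r ek : ℝ) (b b' : PBond P j),
        |Cloc P j (rLen r ek / 4) b b'| ≤ M * Real.exp (4 * δ * L) * (1 + L) ^ 2 * Real.exp (-(δ * distB P j b b')) ∧
        (rLen r ek / 4 + 4 * L < distB P j b b' → Cloc P j (rLen r ek / 4) b b' = 0) ∧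
        |Cloc P j (rLen r ek / 4) b b' - Cmat P j b b'| ≤
          M * Real.exp (2 * δ * L) * (1 + L) ^ 2 * Real.exp (-(δ / 8 * rLen r ek)) * Real.exp (-(δ / 2 * distB P j b b')) := by
  obtain ⟨M, δ, hM, hδ, H⟩ := cloc_estimates d L hd
  refine ⟨M, δ, hM, hδ, fun P hP hPL j inst hj r ek b b' => ?_⟩
  obtain ⟨-, h1, h2, h3⟩ := H P hP hPL j inst hj (rLen r ek / 4) b b'
  refine ⟨h1, h2, ?_⟩
  have hR : δ / 2 * (rLen r ek / 4) = δ / 8 * rLen r ek := by ring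
  rw [hR] at h3
  exact h3

end Estimates

end

end Literature.MathematicalPhysics.QuantumFieldTheory.BalabanImbrieJaffe1984to88.BIJ88ClocEstimatesTorus
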